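import Literature.AlgebraicGeometry.Resolution.BlowupAlgebraStrictTransform
import Literature.AlgebraicGeometry.Resolution.BlowupRegularPairCharts
import Summits.ResolutionOfSingularities.ResolutionOfSingularities.Theorems.EquisingularLiftEquisingularLiftNatSubLiftTrace
import HarnessLib

/-!
# `EquisingularLiftNat`, line `sections`, stub `stub_elnat_three_isolated` — helper SUB-LIFT:
# the strict transform of a sub-curve of the carrier under the blow-up of a Δ-centre

[OURS · L1 W4.5b] Kernel form of the SUB-LIFT device of CRUX-PLAN v3 §1.7 (b) «CONSEQUENCE» (chain
w45b, crux item `EquisingularLiftNat` = stmt-ResolutionOfSingularities-20038, registered line `sections`,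
research stub `stub_elnat_three_isolated`; LEAD-MEMO-1 §4 «SUB-LIFTS»); NOT a statement of any
manuscript. It is the one device of the isolated-singularity carrier game (Δ-curves, combs,
sub-lifts, sections; AVOID / H-CONE for the E1 checks) that had no kernel lemma yet.

GEOMETRY (CRUX-PLAN v3 §1.7 (b), by hand there). Inside an `O`-smooth carrier `Ẽ = V(z)` of the
current ambient `P_i` sits a reducible planar special curve `Z = Z″ ∪ Z‴ = V(z, ϖ, g″g‴)`; the Δ-centre
is `C_Δ = V(z, γ)`, `γ = g̃″g̃‴ + ϖh`, and `D′ = V(z, δ)`, `δ = g̃″ + ϖG′`, is a regular `O`-model of the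
sub-curve `Z″` alone. SUB-LIFT: after blowing up `C_Δ`, the strict transform `C := St_{C_Δ}(D′)` is
ISOMORPHIC TO `D′` (so regular and `O`-flat when `D′` is), it misses the `z`-chart, and its special
fibre is exactly the carrier-direction section `Γ″ = ℙ(N_{Z/Ẽ_k})|_{Z″}` of the exceptional divisor over
`Z″` — the persisting double curve after a Δ-step with deeper transversal type along `Z″`, which is
thereby an admissible E1 trace.

This file is the AMBIENT-CHART half of the device; the `D′`-INTRINSIC half — the trace
`I_{C_Δ}·𝒪_{D′} = (ϖ(h − G′g̃‴))` is a principal Cartier divisor, so `Bl_{trace}(D′) ≅ D′` — is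
`…EquisingularLiftNatSubLiftTrace.lean` (res-L1-w45b-stub-4, p503829), whose
`blowupAlgebra_span_singleton_equiv` is reused below.

CHART ALGEBRA (everything below is proved for an arbitrary commutative ring `R`, the coordinate ring
of an affine chart of `P_i` or a local ring of it). The blow-up along `I = (γ, z)` is covered by the
charts `Spec R[I/γ]` and `Spec R[I/z]` (affine blowup algebras `blowupAlgebra I b ⊆ R[1/b]`,
`Literature/AlgebraicGeometry/Resolution/AffineBlowupAlgebra.lean`); on `R[I/γ]` the exceptional
divisor is `E = V(γ)`, the strict transform of the carrier is `St(Ẽ) = V(t)`, `t := z/γ`, and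
`Γ := V(t, γ) = St(Ẽ) ∩ E` is the CARRIER SECTION of `E → C_Δ`. For an ideal `J ∋ z` of `R` (the
sub-scheme `V(J) ⊆ Ẽ`; `J = (z, δ)` for `D′`) the strict transform of `V(J)` on the `γ`-chart is
`Spec` of the chart ring `(R/J)[Ī/γ̄]` of the blow-up of `R/J` along `Ī = I·(R/J) = (γ̄)`, a quotient
of `R[I/γ]` by the kernel of `blowupAlgebra.mapQuotient I γ J` (Görtz–Wedhorn Prop. 13.96 (2);
`BlowupAlgebraStrictTransform.lean`). We prove, for `(γ, z)` a REGULAR PAIR (`γ` a non-zero-divisor,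
`z` a non-zero-divisor modulo `γ` — the chart presentation `R[I/γ] ≅ R[X]/(γX − z)` of Stacks 0BIQ,
`ringEquiv_quotient_blowupAlgebra_pair`):

* `exists_evalZero_blowupAlgebra_pair` — for every ideal `K ∋ z` there is a surjection
  `Ψ_K : R[I/γ] ↠ R/K` with `Ψ_K(r) = r̄`, `Ψ_K(t) = 0` and KERNEL `(t) + K·R[I/γ]`; packaged as
  `exists_ringEquiv_quotient_blowupAlgebra_pair_sup`: **`R[I/γ]/((t) + K R[I/γ]) ≅ R/K`**. Instances:
  `K = (γ, z)`: `Γ ≅ C_Δ` (the carrier section is a section); `K = (z, δ)`: `V(t, δ) ≅ D′`;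
  `K = (z, δ, ϖ)`: `V(t, δ, ϖ) ≅ Z″`.
* `ker_mapQuotient_pair_eq_sup` — if moreover `γ` is a non-zero-divisor modulo `J` (`γ|_{D′} =
  ϖ(h − G′g̃‴)` is not a zero-divisor on the integral `D′ ⊄ C_Δ`), the kernel of
  `R[I/γ] → (R/J)[Ī/γ̄]` IS `(t) + J R[I/γ]`: **the strict transform of `V(J)` on the `γ`-chart is
  `V(t) ∩ V(J)`, not more** (the `γ`-saturation adds nothing); and
  `exists_ringEquiv_strictTransformChart_pair` (via stub-4's `blowupAlgebra_span_singleton_equiv`) /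
  `exists_ringEquiv_strictTransform_pair`: the chart ring `(R/J)[(γ̄)/γ̄]` is `R/J` itself —
  **`St_{C_Δ}(D′) ≅ D′`**, so the strict transform is regular / `O`-flat / integral exactly when `D′` is.
* `subsingleton_blowupAlgebra_map_of_mem` / `ker_mapQuotient_eq_top_of_mem` — on the `z`-chart the
  strict transform of any `V(J)`, `J ∋ z` (the carrier, `D′`, `C`), is EMPTY.
* `carrierSection_le_specialFibre_strictTransform` — if `γ ∈ K` (e.g. `K = (z, δ, ϖ)`:
  `γ = δ·g̃‴ + ϖ·(h − G′g̃‴)`), then `(t, γ) ≤ (t) + K R[I/γ]`: **the special fibre `V(t, δ, ϖ)` of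
  `C` lies in the carrier section `Γ`**, and by the first item it is `≅ V(z, δ, ϖ) = Z″` over
  `C_Δ ⊇ Z″`: «`C_k = Γ″` exactly».

E1 FOR `Γ″` (that `Γ″` lies on the strict transform `H_{i+1}` of the surface) is the doubled-carrier
tangent-cone criterion ALREADY in tree, read along a curve instead of at a point: at the generic point
`η` of `Z″` the local ring `𝒪_{P_{i,k},η}` is regular of dimension `2` with regular parameters
`(ḡ″, z̄)`, and `exceptionalLine_subset_strictTransform_of_doubledPlaneCone_rsop` (file
`…EquisingularLiftNatExceptionalLineCone.lean`, any `d`, here `d = 2`, chart `b = ḡ″`, carrier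
`e = z̄`) gives `Γ ∩ chart ⊆ St(V(F̄))` as soon as `F̄ ≡ u·z̄² (mod 𝔪_η³)`, `u` a unit — i.e. the
transversal type of `H_i` along `Z″` has the doubled carrier plane as tangent cone (type `A_{≥2}` in
the carrier direction, «deeper transversal type along `Z″`»). All statements [folklore]-level
commutative algebra; axioms standard.
-/

set_option linter.dupNamespace false -- mandated namespace `Summit.<Summit>.<Problem>` of this single-conjunct summit

noncomputable section

namespace Summit.ResolutionOfSingularities.ResolutionOfSingularities.Cruxes.EquisingularLiftNat.Sections

open IsLocalization Literature.AlgebraicGeometry.Resolution Polynomial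
open Summit.ResolutionOfSingularities.ResolutionOfSingularities.Theorems.EquisingularLift.Junction
  (blowupAlgebra_span_singleton_equiv)

universe u

variable {R : Type u} [CommRing R]

/-! ## Bookkeeping on the pair `(γ, z)` -/

/-- `z ∈ (γ, z)`. [folklore] -/
theorem right_mem_span_pair (γ z : R) : z ∈ Ideal.span ({γ, z} : Set R) :=
  Ideal.subset_span (Set.mem_insert_of_mem _ (Set.mem_singleton _))

/-- `γ ∈ (γ, z)`. [folklore] -/
theorem left_mem_span_pair (γ z : R) : γ ∈ Ideal.span ({γ, z} : Set R) :=
  Ideal.subset_span (Set.mem_insert _ _)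

/-- `z = γ · t` on `R[I/γ]`, `t = z/γ`: the equation of the carrier factors through the exceptional
equation, so `z ∈ (t)`. [folklore] -/
theorem algebraMap_right_mem_span_gen (γ z : R) :
    algebraMap R (blowupAlgebra (Ideal.span {γ, z}) γ) z ∈
      Ideal.span {blowupAlgebra.gen (Ideal.span {γ, z}) γ z (right_mem_span_pair γ z)} := by
  rw [← blowupAlgebra.algebraMap_mul_gen (Ideal.span {γ, z}) γ z (right_mem_span_pair γ z)]
  exact Ideal.mul_mem_left _ _ (Ideal.mem_span_singleton_self _)

/-! ## `R[I/γ]/((t) + K) ≅ R/K` for `K ∋ z` (regular pair) -/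

/-- **Evaluation at `t = 0`.** Let `(γ, z)` be a regular pair of `R` (`γ` a non-zero-divisor, `z` a
non-zero-divisor modulo `γ`) and `K ∋ z` an ideal. Then there is a ring map `Ψ : R[I/γ] → R/K`,
`I = (γ, z)`, with `Ψ(r) = r̄` for `r ∈ R`, `Ψ(z/γ) = 0`, and `ker Ψ = (z/γ) + K·R[I/γ]`; in particular
`Ψ` is surjective. (Via the presentation `R[I/γ] ≅ R[X]/(γX − z)`, `X ↦ z/γ`, of Stacks 0BIQ: `Ψ` is
`X ↦ 0`, well defined because `γ·0 − z ∈ K`; an element is `p(z/γ)` and `p = p(0) + X·q`.) [folklore] -/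
theorem exists_evalZero_blowupAlgebra_pair (γ z : R) (hγ : γ ∈ nonZeroDivisors R)
    (hγz : ∀ r : R, γ ∣ r * z → γ ∣ r) (K : Ideal R) (hzK : z ∈ K) :
    ∃ Ψ : blowupAlgebra (Ideal.span {γ, z}) γ →+* R ⧸ K,
      (∀ r, Ψ (algebraMap R _ r) = Ideal.Quotient.mk K r) ∧
      Ψ (blowupAlgebra.gen (Ideal.span {γ, z}) γ z (right_mem_span_pair γ z)) = 0 ∧
      Function.Surjective Ψ ∧
      RingHom.ker Ψ =
        Ideal.span {blowupAlgebra.gen (Ideal.span {γ, z}) γ z (right_mem_span_pair γ z)} ⊔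
          K.map (algebraMap R (blowupAlgebra (Ideal.span {γ, z}) γ)) := by
  obtain ⟨θ, hθC, hθX⟩ := ringEquiv_quotient_blowupAlgebra_pair γ z hγ hγz
  -- `θ (X̄) = t := z/γ`
  have hθt : θ (Ideal.Quotient.mk _ X) =
      blowupAlgebra.gen (Ideal.span {γ, z}) γ z (right_mem_span_pair γ z) := Subtype.ext hθX
  -- `X ↦ 0`, `r ↦ r̄` kills the relation `γ X - z`
  let ev0 : R[X] →+* R ⧸ K := (Ideal.Quotient.mk K).comp (Polynomial.evalRingHom 0)
  have hev0 : ∀ p : R[X], ev0 p = Ideal.Quotient.mk K (p.eval 0) := fun p ↦ rfl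
  have hrel : ∀ p ∈ Ideal.span {C γ * X - C z}, ev0 p = 0 := by
    intro p hp
    obtain ⟨q, rfl⟩ := Ideal.mem_span_singleton'.mp hp
    rw [map_mul, hev0 (C γ * X - C z), Polynomial.eval_sub, Polynomial.eval_mul, Polynomial.eval_C,
      Polynomial.eval_X, Polynomial.eval_C, mul_zero, zero_sub, map_neg,
      Ideal.Quotient.eq_zero_iff_mem.mpr hzK, neg_zero, mul_zero]
  let ψ₀ : (R[X] ⧸ Ideal.span {C γ * X - C z}) →+* R ⧸ K :=
    Ideal.Quotient.lift (Ideal.span {C γ * X - C z}) ev0 hrel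
  have hψ₀ : ∀ p : R[X], ψ₀ (Ideal.Quotient.mk _ p) = Ideal.Quotient.mk K (p.eval 0) := fun p ↦ by
    change Ideal.Quotient.lift _ ev0 hrel (Ideal.Quotient.mk _ p) = _
    rw [Ideal.Quotient.lift_mk, hev0]
  let Ψ : blowupAlgebra (Ideal.span {γ, z}) γ →+* R ⧸ K := ψ₀.comp θ.symm.toRingHom
  have hΨ : ∀ p : R[X], Ψ (θ (Ideal.Quotient.mk _ p)) = Ideal.Quotient.mk K (p.eval 0) := fun p ↦ by
    change ψ₀ (θ.symm (θ (Ideal.Quotient.mk _ p))) = _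
    rw [RingEquiv.symm_apply_apply, hψ₀]
  have hΨC : ∀ r, Ψ (algebraMap R (blowupAlgebra (Ideal.span {γ, z}) γ) r) =
      Ideal.Quotient.mk K r := fun r ↦ by
    rw [← hθC r, hΨ, Polynomial.eval_C]
  have hΨt : Ψ (blowupAlgebra.gen (Ideal.span {γ, z}) γ z (right_mem_span_pair γ z)) = 0 := by
    rw [← hθt, hΨ, Polynomial.eval_X, map_zero]
  refine ⟨Ψ, hΨC, hΨt, fun x ↦ ?_, le_antisymm ?_ ?_⟩
  · obtain ⟨r, rfl⟩ := Ideal.Quotient.mk_surjective x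
    exact ⟨algebraMap R _ r, hΨC r⟩
  · intro g hg
    rw [RingHom.mem_ker] at hg
    -- write `g = θ (p̄)`, `p = X · q + C (p 0)`
    obtain ⟨p, hp⟩ := Ideal.Quotient.mk_surjective (θ.symm g)
    have hgp : g = θ (Ideal.Quotient.mk _ p) := by rw [hp, RingEquiv.apply_symm_apply]
    have hp0 : p.coeff 0 ∈ K := by
      rw [hgp, hΨ, ← Polynomial.coeff_zero_eq_eval_zero] at hg
      exact Ideal.Quotient.eq_zero_iff_mem.mp hg
    have hdecomp : g = blowupAlgebra.gen (Ideal.span {γ, z}) γ z (right_mem_span_pair γ z) *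
          θ (Ideal.Quotient.mk _ p.divX) +
        algebraMap R (blowupAlgebra (Ideal.span {γ, z}) γ) (p.coeff 0) := by
      rw [hgp, ← hθt, ← hθC, ← map_mul θ, ← map_add θ, ← map_mul (Ideal.Quotient.mk _),
        ← map_add (Ideal.Quotient.mk _), Polynomial.X_mul_divX_add]
    rw [hdecomp]
    exact Ideal.add_mem _
      (Ideal.mem_sup_left (Ideal.mul_mem_right _ _ (Ideal.mem_span_singleton_self _)))
      (Ideal.mem_sup_right (Ideal.mem_map_of_mem _ hp0))
  · refine sup_le ?_ ?_
    · rw [Ideal.span_singleton_le_iff_mem, RingHom.mem_ker]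
      exact hΨt
    · rw [Ideal.map_le_iff_le_comap]
      intro k hk
      rw [Ideal.mem_comap, RingHom.mem_ker, hΨC, Ideal.Quotient.eq_zero_iff_mem]
      exact hk

/-- **`R[I/γ]/((z/γ) + K·R[I/γ]) ≅ R/K`** for a regular pair `(γ, z)` and an ideal `K ∋ z`, the
isomorphism sending the class of `r ∈ R` to `r̄` (and the class of `z/γ` to `0`). Geometric instances
on the `γ`-chart of `Bl_{C_Δ}`, `C_Δ = V(γ, z)` inside the carrier `Ẽ = V(z)`: `K = (γ, z)` — the
carrier section `Γ = V(z/γ, γ) = St(Ẽ) ∩ E` is isomorphic to `C_Δ`; `K = (z, δ)` — `V(z/γ, δ) ≅ D′ =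
V(z, δ)`; `K = (z, δ, ϖ)` — `V(z/γ, δ, ϖ) ≅ V(z, δ, ϖ) = Z″`. [folklore] -/
theorem exists_ringEquiv_quotient_blowupAlgebra_pair_sup (γ z : R) (hγ : γ ∈ nonZeroDivisors R)
    (hγz : ∀ r : R, γ ∣ r * z → γ ∣ r) (K : Ideal R) (hzK : z ∈ K) :
    ∃ Φ : (blowupAlgebra (Ideal.span {γ, z}) γ ⧸
        (Ideal.span {blowupAlgebra.gen (Ideal.span {γ, z}) γ z (right_mem_span_pair γ z)} ⊔
          K.map (algebraMap R (blowupAlgebra (Ideal.span {γ, z}) γ)))) ≃+* R ⧸ K,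
      ∀ r, Φ (Ideal.Quotient.mk _ (algebraMap R _ r)) = Ideal.Quotient.mk K r := by
  obtain ⟨Ψ, hΨC, -, hΨsurj, hker⟩ := exists_evalZero_blowupAlgebra_pair γ z hγ hγz K hzK
  refine ⟨(Ideal.quotEquivOfEq hker.symm).trans (RingHom.quotientKerEquivOfSurjective hΨsurj),
    fun r ↦ ?_⟩
  rw [RingEquiv.trans_apply, Ideal.quotEquivOfEq_mk]
  exact (RingHom.quotientKerEquivOfSurjective_apply_mk hΨsurj _).trans (hΨC r)

/-! ## The strict transform of `V(J)`, `J ∋ z`, on the `γ`-chart -/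

/-- `z/γ ↦ z̄/γ̄ = 0` under `R[I/γ] → (R/J)[Ī/γ̄]` when `z ∈ J`: the strict transform of `V(J) ⊆ Ẽ`
lies in the strict transform `V(z/γ)` of the carrier. [folklore] -/
theorem mapQuotient_gen_eq_zero_of_mem (I : Ideal R) (γ z : R) (hz : z ∈ I) (J : Ideal R)
    (hzJ : z ∈ J) : blowupAlgebra.mapQuotient I γ J (blowupAlgebra.gen I γ z hz) = 0 := by
  rw [blowupAlgebra.mapQuotient_gen]
  apply Subtype.ext
  rw [blowupAlgebra.coe_gen, Ideal.Quotient.eq_zero_iff_mem.mpr hzJ, map_zero, zero_mul]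
  rfl

/-- The easy inclusion `(z/γ) + J·R[I/γ] ≤ ker (R[I/γ] → (R/J)[Ī/γ̄])` for `J ∋ z` (no hypothesis on
the pair). [folklore] -/
theorem span_gen_sup_map_le_ker_mapQuotient (γ z : R) (J : Ideal R) (hzJ : z ∈ J) :
    Ideal.span {blowupAlgebra.gen (Ideal.span {γ, z}) γ z (right_mem_span_pair γ z)} ⊔
        J.map (algebraMap R (blowupAlgebra (Ideal.span {γ, z}) γ)) ≤
      RingHom.ker (blowupAlgebra.mapQuotient (Ideal.span {γ, z}) γ J) := by
  refine sup_le ?_ ?_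
  · rw [Ideal.span_singleton_le_iff_mem, RingHom.mem_ker]
    exact mapQuotient_gen_eq_zero_of_mem _ γ z _ J hzJ
  · rw [Ideal.map_le_iff_le_comap]
    intro j hj
    rw [Ideal.mem_comap, RingHom.mem_ker, blowupAlgebra.mapQuotient_algebraMap,
      Ideal.Quotient.eq_zero_iff_mem.mpr hj, map_zero]

/-- `γ̄` is a non-zero-divisor of `R/J` iff `γ·r ∈ J ⇒ r ∈ J`. [folklore] -/
theorem mk_mem_nonZeroDivisors_of_forall_mul_mem (γ : R) (J : Ideal R)
    (hγJ : ∀ r : R, γ * r ∈ J → r ∈ J) : Ideal.Quotient.mk J γ ∈ nonZeroDivisors (R ⧸ J) := by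
  refine (mem_nonZeroDivisors_iff_right).mpr fun x hx ↦ ?_
  obtain ⟨r, rfl⟩ := Ideal.Quotient.mk_surjective x
  rw [mul_comm, ← map_mul, Ideal.Quotient.eq_zero_iff_mem] at hx
  exact Ideal.Quotient.eq_zero_iff_mem.mpr (hγJ r hx)

/-- **The strict transform of `V(J)` on the `γ`-chart is `V(z/γ) ∩ V(J)`.** Let `(γ, z)` be a regular
pair of `R`, `J ∋ z` an ideal, and suppose `γ` is a non-zero-divisor modulo `J`. Then the kernel of
`R[I/γ] → (R/J)[Ī/γ̄]` (`I = (γ, z)`, `Ī = I·(R/J) = (γ̄)`; Görtz–Wedhorn Prop. 13.96 (2): its `Spec`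
is the strict transform of `V(J)`) is exactly `(z/γ) + J·R[I/γ]`: the `γ`-saturation of `J·R[I/γ]`
(`mem_ker_mapQuotient_iff`) stops at `(z/γ) + J·R[I/γ]` because `R[I/γ]/((z/γ) + J R[I/γ]) ≅ R/J` has
`γ̄` as a non-zero-divisor. SUB-LIFT reading: `J = (z, δ)` the regular `O`-model `D′` of `Z″`, `γ|_{D′}`
not a zero-divisor: `St_{C_Δ}(D′) ∩ (γ-chart) = V(z/γ, δ)`. [folklore] -/
theorem ker_mapQuotient_pair_eq_sup (γ z : R) (hγ : γ ∈ nonZeroDivisors R)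
    (hγz : ∀ r : R, γ ∣ r * z → γ ∣ r) (J : Ideal R) (hzJ : z ∈ J)
    (hγJ : ∀ r : R, γ * r ∈ J → r ∈ J) :
    RingHom.ker (blowupAlgebra.mapQuotient (Ideal.span {γ, z}) γ J) =
      Ideal.span {blowupAlgebra.gen (Ideal.span {γ, z}) γ z (right_mem_span_pair γ z)} ⊔
        J.map (algebraMap R (blowupAlgebra (Ideal.span {γ, z}) γ)) := by
  refine le_antisymm ?_ (span_gen_sup_map_le_ker_mapQuotient γ z J hzJ)
  obtain ⟨Ψ, hΨC, -, -, hker⟩ := exists_evalZero_blowupAlgebra_pair γ z hγ hγz J hzJ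
  intro g hg
  obtain ⟨N, hN⟩ := (blowupAlgebra.mem_ker_mapQuotient_iff (Ideal.span {γ, z}) γ J g).mp hg
  -- `γᴺ g ∈ J R[I/γ] ⊆ ker Ψ`, and `γ̄` is a non-zero-divisor of `R/J = R[I/γ]/ker Ψ`
  have hJle : J.map (algebraMap R (blowupAlgebra (Ideal.span {γ, z}) γ)) ≤ RingHom.ker Ψ :=
    hker ▸ le_sup_right
  have hΨN : Ideal.Quotient.mk J γ ^ N * Ψ g = 0 := by
    have := hJle hN
    rwa [RingHom.mem_ker, map_mul, map_pow, hΨC] at this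
  have hreg := pow_mem (mk_mem_nonZeroDivisors_of_forall_mul_mem γ J hγJ) N
  rw [← hker, RingHom.mem_ker]
  rw [mul_comm] at hΨN
  exact (mem_nonZeroDivisors_iff_right.mp hreg) _ hΨN

/-! ## The chart ring of the blow-up of a principal ideal generated by a non-zero-divisor -/

/-- The image ideal `Ī = (γ, z)·(R/J)` IS `(γ̄)` when `z ∈ J`. [folklore] -/
theorem map_span_pair_eq_span_singleton_of_mem (γ z : R) (J : Ideal R) (hzJ : z ∈ J) :
    (Ideal.span {γ, z}).map (Ideal.Quotient.mk J) = Ideal.span {Ideal.Quotient.mk J γ} := by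
  rw [Ideal.map_span, Set.image_pair, Ideal.Quotient.eq_zero_iff_mem.mpr hzJ, Ideal.span_pair_zero]

/-- **The chart ring of the strict transform of `V(J)` is `R/J`** (`J ∋ z`, `γ̄` a non-zero-divisor of
`R/J`): `R/J ≅ (R/J)[Ī/γ̄]`, `Ī = (γ̄)`, through the structure map — the blow-up of `V(J)` along its
Cartier divisor `V(J) ∩ C_Δ = V(γ̄)` is an isomorphism (stub-4's `blowupAlgebra_span_singleton_equiv`,
`…SubLiftTrace.lean`, applied to `Ī = (γ̄)`). SUB-LIFT reading: `St_{C_Δ}(D′) ≅ D′`; in particular the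
strict transform is regular / `O`-flat / integral exactly when `D′` is. [folklore] -/
theorem exists_ringEquiv_strictTransformChart_pair (γ z : R) (J : Ideal R) (hzJ : z ∈ J)
    (hγJ : ∀ r : R, γ * r ∈ J → r ∈ J) :
    ∃ e : (R ⧸ J) ≃+*
        blowupAlgebra ((Ideal.span {γ, z}).map (Ideal.Quotient.mk J)) (Ideal.Quotient.mk J γ),
      ∀ s, e s = algebraMap (R ⧸ J) _ s :=
  blowupAlgebra_span_singleton_equiv _ (mk_mem_nonZeroDivisors_of_forall_mul_mem γ J hγJ)
    (map_span_pair_eq_span_singleton_of_mem γ z J hzJ)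

/-- **SUB-LIFT, assembled.** For a regular pair `(γ, z)`, an ideal `J ∋ z` with `γ` a non-zero-divisor
modulo `J`: the quotient of the `γ`-chart ring `R[I/γ]` by `(z/γ) + J·R[I/γ]` — the closed subscheme
`V(z/γ) ∩ V(J)` of the chart — is isomorphic to the chart ring `(R/J)[Ī/γ̄]` of the strict transform of
`V(J)` (through `mapQuotient`) AND to `R/J` (class of `r` ↦ `r̄`). [folklore] -/
theorem exists_ringEquiv_strictTransform_pair (γ z : R) (hγ : γ ∈ nonZeroDivisors R)
    (hγz : ∀ r : R, γ ∣ r * z → γ ∣ r) (J : Ideal R) (hzJ : z ∈ J)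
    (hγJ : ∀ r : R, γ * r ∈ J → r ∈ J) :
    (∃ Θ : (blowupAlgebra (Ideal.span {γ, z}) γ ⧸
        (Ideal.span {blowupAlgebra.gen (Ideal.span {γ, z}) γ z (right_mem_span_pair γ z)} ⊔
          J.map (algebraMap R (blowupAlgebra (Ideal.span {γ, z}) γ)))) ≃+*
        blowupAlgebra ((Ideal.span {γ, z}).map (Ideal.Quotient.mk J)) (Ideal.Quotient.mk J γ),
      ∀ g, Θ (Ideal.Quotient.mk _ g) = blowupAlgebra.mapQuotient (Ideal.span {γ, z}) γ J g) ∧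
    (∃ Φ : (blowupAlgebra (Ideal.span {γ, z}) γ ⧸
        (Ideal.span {blowupAlgebra.gen (Ideal.span {γ, z}) γ z (right_mem_span_pair γ z)} ⊔
          J.map (algebraMap R (blowupAlgebra (Ideal.span {γ, z}) γ)))) ≃+* R ⧸ J,
      ∀ r, Φ (Ideal.Quotient.mk _ (algebraMap R _ r)) = Ideal.Quotient.mk J r) := by
  refine ⟨?_, exists_ringEquiv_quotient_blowupAlgebra_pair_sup γ z hγ hγz J hzJ⟩
  have hker := ker_mapQuotient_pair_eq_sup γ z hγ hγz J hzJ hγJ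
  have hsurj := blowupAlgebra.mapQuotient_surjective (Ideal.span {γ, z}) γ J
  refine ⟨(Ideal.quotEquivOfEq hker.symm).trans (RingHom.quotientKerEquivOfSurjective hsurj),
    fun g ↦ ?_⟩
  rw [RingEquiv.trans_apply, Ideal.quotEquivOfEq_mk]
  exact RingHom.quotientKerEquivOfSurjective_apply_mk hsurj _

/-! ## The `z`-chart: the strict transform of the carrier is empty -/

/-- **On the `b`-chart the strict transform of any `V(J)` with `b ∈ J` is empty**: the chart ring
`(R/J)[Ī/b̄]` lives inside `(R/J)[1/b̄] = (R/J)[1/0] = 0`. SUB-LIFT reading (`b = z`): the strict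
transforms of the carrier `Ẽ = V(z)`, of `D′` and of `C` all miss the `z`-chart of `Bl_{(γ, z)}`.
[folklore] -/
theorem subsingleton_blowupAlgebra_map_of_mem (I : Ideal R) (b : R) (J : Ideal R) (hbJ : b ∈ J) :
    Subsingleton (blowupAlgebra (I.map (Ideal.Quotient.mk J)) (Ideal.Quotient.mk J b)) := by
  have h0 : (0 : R ⧸ J) ∈ Submonoid.powers (Ideal.Quotient.mk J b) := by
    rw [Submonoid.mem_powers_iff]
    exact ⟨1, by rw [pow_one, Ideal.Quotient.eq_zero_iff_mem.mpr hbJ]⟩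
  haveI : Subsingleton (Localization.Away (Ideal.Quotient.mk J b)) :=
    (IsLocalization.uniqueOfZeroMem (S := Localization.Away (Ideal.Quotient.mk J b)) h0).instSubsingleton
  infer_instance

/-- Hence the whole `b`-chart ring is the kernel of `R[I/b] → (R/J)[Ī/b̄]` when `b ∈ J`. [folklore] -/
theorem ker_mapQuotient_eq_top_of_mem (I : Ideal R) (b : R) (J : Ideal R) (hbJ : b ∈ J) :
    RingHom.ker (blowupAlgebra.mapQuotient I b J) = ⊤ := by
  haveI := subsingleton_blowupAlgebra_map_of_mem I b J hbJ
  exact eq_top_iff.mpr fun g _ ↦ RingHom.mem_ker.mpr (Subsingleton.elim _ _)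

/-! ## The special fibre of the sub-lift lies in the carrier section -/

/-- **`C_k ⊆ Γ`.** If `γ ∈ K` (SUB-LIFT: `K = (z, δ, ϖ)` the ideal of the special fibre of `D′ = V(z, δ)`,
and `γ = g̃″g̃‴ + ϖh = δ·g̃‴ + ϖ·(h − G′g̃‴) ∈ (δ, ϖ)`), then on the `γ`-chart the ideal `(z/γ, γ)` of
the carrier section `Γ = St(Ẽ) ∩ E` is contained in the ideal `(z/γ) + K·R[I/γ]` of `V(z/γ) ∩ V(K)`:
the special fibre of the strict transform `C = V(z/γ, δ)` of `D′` lies in `Γ`, and (by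
`exists_ringEquiv_quotient_blowupAlgebra_pair_sup` for `K` and for `(γ, z)`) it is the piece of
`Γ ≅ C_Δ` lying over `V(K) = Z″ ⊆ C_Δ` — «`C_k = Γ″` exactly». [folklore] -/
theorem carrierSection_le_specialFibre_strictTransform (γ z : R) (K : Ideal R) (hγK : γ ∈ K) :
    Ideal.span {blowupAlgebra.gen (Ideal.span {γ, z}) γ z (right_mem_span_pair γ z),
        algebraMap R (blowupAlgebra (Ideal.span {γ, z}) γ) γ} ≤
      Ideal.span {blowupAlgebra.gen (Ideal.span {γ, z}) γ z (right_mem_span_pair γ z)} ⊔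
        K.map (algebraMap R (blowupAlgebra (Ideal.span {γ, z}) γ)) := by
  rw [Ideal.span_le]
  intro x hx
  rcases hx with rfl | hx
  · exact Ideal.mem_sup_left (Ideal.mem_span_singleton_self _)
  · rw [Set.mem_singleton_iff.mp hx]
    exact Ideal.mem_sup_right (Ideal.mem_map_of_mem _ hγK)

/-- The carrier section is a section: `(z/γ, γ) = (z/γ) + (γ, z)·R[I/γ]` (since `z = γ·(z/γ)`), so that
`exists_ringEquiv_quotient_blowupAlgebra_pair_sup` with `K = (γ, z)` reads **`Γ ≅ C_Δ = V(γ, z)`**.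
[folklore] -/
theorem span_carrierSection_eq_sup (γ z : R) :
    Ideal.span {blowupAlgebra.gen (Ideal.span {γ, z}) γ z (right_mem_span_pair γ z),
        algebraMap R (blowupAlgebra (Ideal.span {γ, z}) γ) γ} =
      Ideal.span {blowupAlgebra.gen (Ideal.span {γ, z}) γ z (right_mem_span_pair γ z)} ⊔
        (Ideal.span {γ, z}).map (algebraMap R (blowupAlgebra (Ideal.span {γ, z}) γ)) := by
  apply le_antisymm
  · exact carrierSection_le_specialFibre_strictTransform γ z _ (left_mem_span_pair γ z)
  · refine sup_le (Ideal.span_mono (Set.singleton_subset_iff.mpr (Set.mem_insert _ _))) ?_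
    rw [Ideal.map_span, Ideal.span_le]
    rintro _ ⟨x, hx, rfl⟩
    rcases hx with rfl | hx
    · exact Ideal.subset_span (Set.mem_insert_of_mem _ (Set.mem_singleton _))
    · rw [Set.mem_singleton_iff.mp hx]
      exact Ideal.span_mono (Set.singleton_subset_iff.mpr (Set.mem_insert _ _))
        (algebraMap_right_mem_span_gen _ _)

/-- **`Γ ≅ C_Δ`**: for a regular pair `(γ, z)`, the carrier section `V(z/γ, γ)` of the `γ`-chart is
isomorphic to the centre `V(γ, z)`, class of `r` ↦ `r̄`. [folklore] -/
theorem exists_ringEquiv_carrierSection (γ z : R) (hγ : γ ∈ nonZeroDivisors R)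
    (hγz : ∀ r : R, γ ∣ r * z → γ ∣ r) :
    ∃ Φ : (blowupAlgebra (Ideal.span {γ, z}) γ ⧸
        Ideal.span {blowupAlgebra.gen (Ideal.span {γ, z}) γ z (right_mem_span_pair γ z),
          algebraMap R (blowupAlgebra (Ideal.span {γ, z}) γ) γ}) ≃+* R ⧸ Ideal.span {γ, z},
      ∀ r, Φ (Ideal.Quotient.mk _ (algebraMap R _ r)) = Ideal.Quotient.mk _ r := by
  obtain ⟨Φ, hΦ⟩ := exists_ringEquiv_quotient_blowupAlgebra_pair_sup γ z hγ hγz (Ideal.span {γ, z})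
    (right_mem_span_pair γ z)
  refine ⟨(Ideal.quotEquivOfEq (span_carrierSection_eq_sup γ z)).trans Φ, fun r ↦ ?_⟩
  rw [RingEquiv.trans_apply, Ideal.quotEquivOfEq_mk, hΦ]

end Summit.ResolutionOfSingularities.ResolutionOfSingularities.Cruxes.EquisingularLiftNat.Sections

end
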